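import Summits.CriticalPhenomena.CardyFormulaZ2.Theorems.CardyFlipRussoVoronoiHubFromSmirnovCrossSubsetGraph
import Summits.CriticalPhenomena.CardyFormulaZ2.Theorems.CardyFlipRussoVoronoiHubFromSmirnovNoVoid
import Mathlib.Analysis.SpecialFunctions.Log.Basic
import Mathlib.Analysis.SpecialFunctions.Pow.Asymptotics

/-!
# The easy half of S3b-ii (`Sig.stub_graphVsContinuum`) of line `moebius-exact-delaunay-dilation-ward`
# (crux `VoronoiHubFromSmirnov`, stmt-CriticalPhenomena-6433) — lead c3

**Continuum crossing ⇒ graph crossing, up to `o(1)`.**  For every admissible profile `ρ`, every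
conformal rectangle and every admissible carrier / attachment families (`IsDomainFamily`,
`IsAttachment`, GraphDefs module), eventually as `δ → 0⁺`,
`crossProb ρ 1 R δ ≤ P_ρ(graphCross (K δ) (A₀ δ) (A₂ δ) δ) + ε`.

Proof: on the event that both colour classes are non-empty (a.s., `im_lawBW_real_fst/snd_not_nonempty`)
and that every point of `closure Ω` has a black nucleus within configuration distance
`ℓ = C √|log δ|` (probability `→ 1`, `poisson_noVoid_tendsto`), the continuum crossing event is
contained in the graph crossing event as soon as the `ℓδ`-neighbourhoods of `closure Ω` and of the
arcs are inside `K δ`, `A₀ δ`, `A₂ δ` (`crossEvent_subset_graphCross_of_noVoid`, p157461) — which the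
families guarantee eventually, because `ℓ δ = C δ √|log δ| ≪ a √δ`.  The other half of S3b-ii
(graph crossing ⇒ continuum crossing) is the Jordan boundary layer and needs RSW; it is not here.
No new definitions.
-/

noncomputable section

namespace Summit.CriticalPhenomena.CardyFormulaZ2.Cruxes.VoronoiHubFromSmirnov.MoebiusExactDelaunayDilationWard

open scoped Topology ENNReal
open Filter Set MeasureTheory Metric
open Literature.Analysis.FunctionSpaces
open Literature.Probability.RandomPlanarGeometry

/-- First-marginal bound for the two-colour law, for EVERY set: `P_BW{c | c.1 ∈ E} ≤ P{E}`
(outer measures: pass to a measurable hull of `E`). -/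
theorem cle_lawBW_real_fst_le (μ : Measure ℂ) [IsProbabilityMeasure (poissonLaw μ)]
    (E : Set (PointConfig ℂ)) :
    (lawBW μ).real {c : PointConfig ℂ × PointConfig ℂ | c.1 ∈ E} ≤ (poissonLaw μ).real E := by
  have hsub : {c : PointConfig ℂ × PointConfig ℂ | c.1 ∈ E} ⊆
      toMeasurable (poissonLaw μ) E ×ˢ (univ : Set (PointConfig ℂ)) := fun c hc =>
    ⟨subset_toMeasurable _ _ hc, mem_univ _⟩
  haveI : IsProbabilityMeasure (lawBW μ) := by unfold lawBW; infer_instance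
  calc (lawBW μ).real {c : PointConfig ℂ × PointConfig ℂ | c.1 ∈ E}
      ≤ (lawBW μ).real (toMeasurable (poissonLaw μ) E ×ˢ (univ : Set (PointConfig ℂ))) :=
        measureReal_mono hsub (measure_ne_top _ _)
    _ = (poissonLaw μ).real (toMeasurable (poissonLaw μ) E) := by
        rw [lawBW, measureReal_prod_prod, probReal_univ, mul_one]
    _ = (poissonLaw μ).real E := by
        rw [measureReal_def, measureReal_def, measure_toMeasurable]

/-- Eventually `C δ √|log δ| ≤ a √δ` and `δ < 1`, for all positive constants `C`, `a`. -/
theorem cle_eventually_scale {C a : ℝ} (hC : 0 < C) (ha : 0 < a) :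
    ∀ᶠ δ : ℝ in 𝓝[>] 0, C * Real.sqrt |Real.log δ| * δ ≤ a * Real.sqrt δ ∧ δ < 1 := by
  have h1 : Tendsto (fun δ : ℝ => δ * |Real.log δ|) (𝓝[>] 0) (𝓝 0) := by
    have h := tendsto_log_mul_rpow_nhdsGT_zero zero_lt_one
    simp only [Real.rpow_one] at h
    have h' : Tendsto (fun δ : ℝ => |Real.log δ * δ|) (𝓝[>] 0) (𝓝 0) := by
      simpa using h.abs
    refine h'.congr' ?_
    filter_upwards [self_mem_nhdsWithin] with δ hδ
    rw [abs_mul, abs_of_pos (show (0:ℝ) < δ from hδ), mul_comm]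
  have hsmall : ∀ᶠ δ : ℝ in 𝓝[>] 0, δ * |Real.log δ| < (a / C) ^ 2 :=
    (tendsto_order.1 h1).2 _ (by positivity)
  have hlt1 : ∀ᶠ δ : ℝ in 𝓝[>] 0, δ < 1 := by
    have : Set.Ioo (0:ℝ) 1 ∈ 𝓝[>] (0:ℝ) := Ioo_mem_nhdsGT one_pos
    filter_upwards [this] with δ hδ
    exact hδ.2
  filter_upwards [hsmall, hlt1, self_mem_nhdsWithin] with δ hδ hδ1 hδ0
  refine ⟨?_, hδ1⟩
  have hδ0' : (0:ℝ) < δ := hδ0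
  have hsq : Real.sqrt (δ * |Real.log δ|) ≤ a / C := by
    rw [← Real.sqrt_sq (by positivity : (0:ℝ) ≤ a / C)]
    exact Real.sqrt_le_sqrt hδ.le
  have hid : C * Real.sqrt |Real.log δ| * δ = C * (Real.sqrt δ * Real.sqrt (δ * |Real.log δ|)) := by
    rw [← Real.sqrt_mul hδ0'.le, show δ * (δ * |Real.log δ|) = δ ^ 2 * |Real.log δ| by ring,
      Real.sqrt_mul (sq_nonneg _), Real.sqrt_sq hδ0'.le]
    ring
  rw [hid]
  calc C * (Real.sqrt δ * Real.sqrt (δ * |Real.log δ|)) ≤ C * (Real.sqrt δ * (a / C)) := by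
        gcongr
    _ = a * Real.sqrt δ := by field_simp

/-- **Continuum crossing ⇒ graph crossing up to `o(1)`** (registered helper of the crux; the easy
half of S3b-ii `Sig.stub_graphVsContinuum`). -/
theorem crossProb_le_graphCross_eventually : ∀ (ρ : ℂ → ℝ), AdmissibleDensity ρ → ∀ (R : ConformalRectangle) (K A₀ A₂ : ℝ → Set ℂ), IsDomainFamily R K → IsAttachment R 0 A₀ → IsAttachment R 2 A₂ → ∀ ε : ℝ, 0 < ε → ∀ᶠ δ : ℝ in nhdsWithin (0 : ℝ) (Set.Ioi 0), crossProb ρ 1 R δ ≤ (lawBW (intensity ρ 1 δ)).real (graphCross (K δ) (A₀ δ) (A₂ δ) δ) + ε := by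
  intro ρ hρ R K A₀ A₂ hK hA₀ hA₂ ε hε
  obtain ⟨C, hC, hvoid⟩ :=
    poisson_noVoid_tendsto ρ hρ (closure R.carrier) R.isBounded.isCompact_closure
  obtain ⟨aK, bK, haK, -, hKev⟩ := hK
  obtain ⟨a0, b0, ha0, -, hA0ev⟩ := hA₀
  obtain ⟨a2, b2, ha2, -, hA2ev⟩ := hA₂
  set a : ℝ := min aK (min a0 a2) with ha
  have hapos : 0 < a := lt_min haK (lt_min ha0 ha2)
  have hεev : ∀ᶠ δ : ℝ in 𝓝[>] 0, (poissonLaw (intensity ρ 1 δ)).real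
      {c | ∃ z ∈ closure R.carrier, ∀ q ∈ c, C * Real.sqrt |Real.log δ| ≤ dist q (z / (δ : ℂ))} < ε :=
    (tendsto_order.1 hvoid).2 ε hε
  filter_upwards [hKev, hA0ev, hA2ev, cle_eventually_scale hC hapos, hεev, self_mem_nhdsWithin]
    with δ hKδ hA0δ hA2δ hsc hεδ hδ0
  have hδ : (0:ℝ) < δ := hδ0
  set ℓ : ℝ := C * Real.sqrt |Real.log δ| with hℓ
  have hℓpos : 0 < ℓ := by
    have hlog : Real.log δ < 0 := Real.log_neg hδ hsc.2
    exact mul_pos hC (Real.sqrt_pos.2 (abs_pos.2 hlog.ne))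
  -- the `ℓδ`-neighbourhoods sit inside the families
  have hthick : ∀ (T : Set ℂ) {a' : ℝ} (A : Set ℂ), a ≤ a' →
      Metric.thickening (a' * Real.sqrt δ) T ⊆ A → Metric.thickening (ℓ * δ) T ⊆ A := by
    intro T a' A haa' hTA
    refine (Metric.thickening_mono ?_ T).trans hTA
    calc ℓ * δ ≤ a * Real.sqrt δ := hsc.1
      _ ≤ a' * Real.sqrt δ := by gcongr
  have hKin : Metric.thickening (ℓ * δ) (closure R.carrier) ⊆ K δ :=
    hthick _ _ (min_le_left _ _) hKδ.2.1
  have hA0in : Metric.thickening (ℓ * δ) (R.arc 0) ⊆ A₀ δ :=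
    hthick _ _ ((min_le_right _ _).trans (min_le_left _ _)) hA0δ.2.1
  have hA2in : Metric.thickening (ℓ * δ) (R.arc 2) ⊆ A₂ δ :=
    hthick _ _ ((min_le_right _ _).trans (min_le_right _ _)) hA2δ.2.1
  -- the inclusion of events
  set Vd : Set (PointConfig ℂ) :=
    {d | ∃ z ∈ closure R.carrier, ∀ q ∈ d, ℓ ≤ dist q (z / (δ : ℂ))} with hVd
  have hincl : crossEvent R δ ⊆ graphCross (K δ) (A₀ δ) (A₂ δ) δ ∪
      ({c : PointConfig ℂ × PointConfig ℂ | ¬ (c.1 : Set ℂ).Nonempty} ∪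
        {c | ¬ (c.2 : Set ℂ).Nonempty} ∪ {c | c.1 ∈ Vd}) := by
    intro c hc
    by_cases h1 : (c.1 : Set ℂ).Nonempty
    · by_cases h2 : (c.2 : Set ℂ).Nonempty
      · by_cases hv : c.1 ∈ Vd
        · exact Or.inr (Or.inr hv)
        · refine Or.inl (crossEvent_subset_graphCross_of_noVoid R δ ℓ (K δ) (A₀ δ) (A₂ δ) c hδ hℓpos
            h1 h2 (fun z hz => ?_) hKin hA0in hA2in hc)
          simp only [hVd, mem_setOf_eq, not_exists, not_and, not_forall, not_le] at hv
          obtain ⟨q, hq, hqz⟩ := hv z hz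
          exact ⟨q, Or.inl hq, by rwa [dist_comm] at hqz⟩
      · exact Or.inr (Or.inl (Or.inr h2))
    · exact Or.inr (Or.inl (Or.inl h1))
  -- measure
  haveI := isProbabilityMeasure_lawBW_intensity ρ hρ.continuous 1 δ
  haveI := isProbabilityMeasure_poissonLaw_intensity ρ hρ.continuous 1 δ
  have hN1 := im_lawBW_real_fst_not_nonempty hρ (t := 1) ⟨zero_le_one, le_rfl⟩ δ
  have hN2 := im_lawBW_real_snd_not_nonempty hρ (t := 1) ⟨zero_le_one, le_rfl⟩ δ
  have hV : (lawBW (intensity ρ 1 δ)).real {c : PointConfig ℂ × PointConfig ℂ | c.1 ∈ Vd} < ε :=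
    (cle_lawBW_real_fst_le _ Vd).trans_lt hεδ
  unfold crossProb
  calc (lawBW (intensity ρ 1 δ)).real (crossEvent R δ)
      ≤ (lawBW (intensity ρ 1 δ)).real (graphCross (K δ) (A₀ δ) (A₂ δ) δ ∪
          ({c : PointConfig ℂ × PointConfig ℂ | ¬ (c.1 : Set ℂ).Nonempty} ∪
            {c | ¬ (c.2 : Set ℂ).Nonempty} ∪ {c | c.1 ∈ Vd})) :=
        measureReal_mono hincl (measure_ne_top _ _)
    _ ≤ (lawBW (intensity ρ 1 δ)).real (graphCross (K δ) (A₀ δ) (A₂ δ) δ) +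
          ((lawBW (intensity ρ 1 δ)).real {c : PointConfig ℂ × PointConfig ℂ | ¬ (c.1 : Set ℂ).Nonempty}
            + (lawBW (intensity ρ 1 δ)).real {c : PointConfig ℂ × PointConfig ℂ | ¬ (c.2 : Set ℂ).Nonempty}
            + (lawBW (intensity ρ 1 δ)).real {c : PointConfig ℂ × PointConfig ℂ | c.1 ∈ Vd}) := by
        refine (measureReal_union_le _ _).trans (add_le_add le_rfl ?_)
        exact (measureReal_union_le _ _).trans (add_le_add (measureReal_union_le _ _) le_rfl)
    _ ≤ (lawBW (intensity ρ 1 δ)).real (graphCross (K δ) (A₀ δ) (A₂ δ) δ) + ε := by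
        rw [hN1, hN2, zero_add, zero_add]
        exact add_le_add le_rfl hV.le

end Summit.CriticalPhenomena.CardyFormulaZ2.Cruxes.VoronoiHubFromSmirnov.MoebiusExactDelaunayDilationWard

end
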